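import Summits.CriticalPhenomena.PercolationContinuityZ3.Theorems.PercNearOneGluingAdditiveGluingBasePeel
import Literature.Probability.Percolation.KozmaNitzanPreFKG
import Literature.Probability.LatticeModels.ProdBernoulliCoupling
import HarnessLib

/-!
# `NoHeavyLowerTail` (stmt-CriticalPhenomena-4575) — the UP-SET EXCHANGE lemma: Kozma–Nitzan's Lemma 5
# with the comparison relay ranked in the UNGLUED graph

Support file (hull-port / coupling seat `prim-hp-1` gen 7; `--supports stmt-CriticalPhenomena-4575`).
No definitions, no named facts, no sorries.

Setting: `μ = prodBernoulli w` on the pairs of `Fin n`; a vertex set `S` (the block to be glued) on which `w`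
has no internal positive pair; `glue_S w` (every non-loop pair inside `S` gets weight `1`) is the graph with `S`
contracted.  Kozma–Nitzan's Lemma 5 (arXiv:2401.12397 p. 13; tree `KozmaNitzan2024_lemma5`) compares a
relay `a` with the glued block on an EXACT star piece, the relay being ranked in the vertex-DELETED graph.
Here the relay is ranked in the UNGLUED graph `w` itself (the members of `S` present as separate vertices
with all their edges) and the conclusion holds on every UP-SET piece:

* `upsetExchange` — if `μ_w(a ↔ b) ≤ μ_w(v ↔ b)` for a vertex `v ∉ S`, then for every finite set `C` of
  non-loop pairs meeting `S` that contains a pair `s(s₀, v)` (`s₀ ∈ S`),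
  `μ_{glue_S w}(a ↔ b, C open) ≤ μ_{glue_S w}(v ↔ b, C open)`  (and `{v ↔ b} ∩ {C open} = {S ↔ b} ∩ {C open}`).
  Proof (the ε-trick of Kozma–Nitzan's Lemma 5 moved inside the block): give the internal pairs `F` of `S`
  weight `ε`; the hypothesis survives with error `|F|ε` (`μ_{w_ε}(a↔b) ≤ μ_w(a↔b) + |F|ε`,
  `μ_w(v↔b) ≤ μ_{w_ε}(v↔b)`); the event `{F ∪ C open}` is increasing and a function of the open cluster of `v`
  (it says `F ∪ C ⊆ C_v`), so Lemma 3(i) (`KozmaNitzan2024_lemma3_i`, BHK) gives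
  `μ_{w_ε}(a↔b, F∪C open) ≤ μ_{w_ε}(v↔b, F∪C open) + |F|ε·μ_{w_ε}(F∪C open)`; and
  `μ_{w_ε}(X, F open, C open) = ε^{|F|}·μ_{glue_S w}(X, C open)` (independence of the coordinates in `F`
  and the glue push-forward `ω ↦ ω ∪ F`).  Divide by `ε^{|F|}` and let `ε → 0`.

Why (memo HULLPORT-COUPLING.md §48): for a depth-two observer (`S = {o} ∪ hubs`, `w = G` with the edges at
`o` deleted) this is the family of 'up-set' inequalities certifying Kozma–Nitzan's Question 9 piece by piece;
the same statement applied to `w` with further pairs deleted gives the conditioned (`R` closed) variants.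
-/

namespace Summit.CriticalPhenomena.PercolationContinuityZ3.Theorems

open MeasureTheory Set ProbabilityTheory
open Literature.Probability.LatticeModels
open Literature.Probability.Percolation
open Literature.Probability.Percolation.KNPreFKG

noncomputable section
open Classical

namespace UpsetExchange

variable {n : ℕ}

/-- The coin of `e` under `w'`, mapped by `P ↦ P ∧ e ∉ D`, is the coin of `e` under `w` when `w = 0` on `D`
and `w' = w` off `D`. [folklore] -/
theorem killSet_map_coin (w w' : Sym2 (Fin n) → unitInterval) (D : Set (Sym2 (Fin n)))
    (h1 : ∀ e ∈ D, w e = 0) (h2 : ∀ e ∉ D, w' e = w e) (e : Sym2 (Fin n)) :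
    (Ber(True, False, w' e)).map (fun P : Prop => P ∧ e ∉ D) = Ber(True, False, w e) := by
  rw [map_bernoulliMeasure]
  by_cases hD : e ∈ D
  · have ha : (True ∧ e ∉ D) = False := propext (iff_false_intro fun h => h.2 hD)
    have hb : (False ∧ e ∉ D) = False := propext (iff_false_intro fun h => h.1)
    simp only [ha, hb, h1 e hD, bernoulliMeasure_self_eq_dirac, bernoulliMeasure_zero]
  · have ha : (True ∧ e ∉ D) = True := propext (iff_true_intro ⟨trivial, hD⟩)
    have hb : (False ∧ e ∉ D) = False := propext (iff_false_intro fun h => h.1)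
    simp only [ha, hb, h2 e hD]

/-- **Deleting the pairs of `D` is a push-forward**: if `w = 0` on `D` and `w' = w` off `D`, then
`μ_w(E) = μ_{w'}{ω | ω ∖ D ∈ E}`. [folklore; Grimmett 1999 §1.3] -/
theorem killSet_pushforward (w w' : Sym2 (Fin n) → unitInterval) (D : Set (Sym2 (Fin n)))
    (h1 : ∀ e ∈ D, w e = 0) (h2 : ∀ e ∉ D, w' e = w e) (E : Set (BondConfig (Fin n))) :
    (prodBernoulli w).real E =
      (prodBernoulli w').real {ω : BondConfig (Fin n) | (ω \ D : BondConfig (Fin n)) ∈ E} := by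
  have hmap : (prodBernoulli w').map (fun ω : BondConfig (Fin n) => (ω \ D : BondConfig (Fin n))) =
      prodBernoulli w := by
    have h := sigmaLaw_prodBernoulli_map_coordwise w' w (fun (e : Sym2 (Fin n)) (P : Prop) => P ∧ e ∉ D)
      (killSet_map_coin w w' D h1 h2)
    have hfun : (fun ω : Set (Sym2 (Fin n)) => {e | (fun (e : Sym2 (Fin n)) (P : Prop) => P ∧ e ∉ D) e (e ∈ ω)}) =
        fun ω : BondConfig (Fin n) => (ω \ D : BondConfig (Fin n)) := by
      funext ω; ext e; simp
    rw [hfun] at h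
    exact h
  have hmeas : Measurable fun ω : BondConfig (Fin n) => (ω \ D : BondConfig (Fin n)) := Measurable.of_discrete
  rw [measureReal_def, measureReal_def, ← hmap, Measure.map_apply hmeas MeasurableSet.of_discrete]
  rfl

/-- If all pairs of `F ∪ C` are open, `F` is the set of non-loop pairs inside `S`, every pair of `C` is a
non-loop pair meeting `S`, and `s(s₀, v) ∈ C` with `s₀ ∈ S`, then every pair of `F ∪ C` lies in the open
cluster of `v`. [folklore] -/
theorem subset_openEdgeCluster_of_open (S : Finset (Fin n)) (C : Finset (Sym2 (Fin n))) (v s₀ : Fin n)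
    (hs₀ : s₀ ∈ S) (hsv : s(s₀, v) ∈ C) (hvs : v ≠ s₀)
    (hC : ∀ e ∈ C, ¬ e.IsDiag ∧ ∃ x ∈ e, x ∈ S)
    (ω : BondConfig (Fin n))
    (hF : ∀ e : Sym2 (Fin n), (∀ x ∈ e, x ∈ S) → ¬ e.IsDiag → e ∈ ω) (hCω : (↑C : Set (Sym2 (Fin n))) ⊆ ω) :
    (∀ e : Sym2 (Fin n), (∀ x ∈ e, x ∈ S) → ¬ e.IsDiag → e ∈ openEdgeCluster ω v) ∧
      (↑C : Set (Sym2 (Fin n))) ⊆ openEdgeCluster ω v := by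
  -- `v` reaches `s₀`, hence every vertex of `S`
  have hvs₀ : (openGraph ω).Reachable v s₀ := by
    have he : s(v, s₀) ∈ ω := by rw [Sym2.eq_swap]; exact hCω hsv
    exact ((openGraph_adj ω v s₀).2 ⟨he, hvs⟩).reachable
  have hvS : ∀ s ∈ S, (openGraph ω).Reachable v s := by
    intro s hs
    by_cases hss : s = s₀
    · rw [hss]; exact hvs₀
    · have he : s(s₀, s) ∈ ω := hF _ (fun x hx => by
        rcases Sym2.mem_iff.1 hx with rfl | rfl <;> assumption) (by
        rw [Sym2.mk_isDiag_iff]; exact fun h => hss h.symm)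
      exact hvs₀.trans ((openGraph_adj ω s₀ s).2 ⟨he, fun h => hss h.symm⟩).reachable
  refine ⟨fun e heS hed => ⟨hF e heS hed, hed, fun x hx => hvS x (heS x hx)⟩, fun e he => ?_⟩
  obtain ⟨hed, x, hx, hxS⟩ := hC e he
  have heω : e ∈ ω := hCω he
  refine ⟨heω, hed, fun y hy => ?_⟩
  by_cases hyx : y = x
  · rw [hyx]; exact hvS x hxS
  · -- `e = s(x, y)`, open: reach `x ∈ S`, then `y`
    have hexy : e = s(x, y) := (Sym2.mem_and_mem_iff (Ne.symm hyx)).1 ⟨hx, hy⟩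
    have hxy : s(x, y) ∈ ω := by rw [← hexy]; exact heω
    exact (hvS x hxS).trans ((openGraph_adj ω x y).2 ⟨hxy, Ne.symm hyx⟩).reachable

/-- **Independence bookkeeping for forcing the pairs of `F` open.**  If `w' = 1` on `F` and `w' = u` off `F`,
then for every event `Y`, `μ_u({F open} ∩ {ω | ω ∪ F ∈ Y}) = (∏_{e ∈ F} u e) · μ_{w'}(Y)`. [folklore; Grimmett 1999 §1.3, §2.2] -/
theorem real_forceOpen_inter (u w' : Sym2 (Fin n) → unitInterval) (F : Finset (Sym2 (Fin n)))
    (h1 : ∀ e ∈ F, w' e = 1) (h2 : ∀ e ∉ F, w' e = u e) (Y : Set (BondConfig (Fin n))) :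
    (prodBernoulli u).real ({ω | (↑F : Set (Sym2 (Fin n))) ⊆ ω} ∩
        {ω | ((ω ∪ ↑F : Set (Sym2 (Fin n))) : BondConfig (Fin n)) ∈ Y}) =
      (∏ e ∈ F, (u e : ℝ)) * (prodBernoulli w').real Y := by
  classical
  have hA : DeterminedBy {ω : BondConfig (Fin n) | (↑F : Set (Sym2 (Fin n))) ⊆ ω} (↑F : Set (Sym2 (Fin n))) := by
    rw [determinedBy_iff]
    intro ω ω' hωω'
    simp only [mem_setOf_eq]
    constructor
    · intro h e he
      have := Set.ext_iff.1 hωω' e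
      simp only [mem_inter_iff, he, and_true] at this
      exact this.1 (h he)
    · intro h e he
      have := Set.ext_iff.1 hωω' e
      simp only [mem_inter_iff, he, and_true] at this
      exact this.2 (h he)
  have hB : DeterminedBy {ω : BondConfig (Fin n) | ((ω ∪ ↑F : Set (Sym2 (Fin n))) : BondConfig (Fin n)) ∈ Y}
      (↑F : Set (Sym2 (Fin n)))ᶜ := by
    rw [determinedBy_iff]
    intro ω ω' hωω'
    simp only [mem_setOf_eq]
    suffices h : (ω ∪ ↑F : Set (Sym2 (Fin n))) = ω' ∪ ↑F by rw [h]
    ext e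
    by_cases he : e ∈ (↑F : Set (Sym2 (Fin n)))
    · simp [he]
    · have := Set.ext_iff.1 hωω' e
      simp only [mem_inter_iff, mem_compl_iff, he, not_false_eq_true, and_true] at this
      simp [he, this]
  rw [prodBernoulli_real_inter_of_determinedBy u F hA hB MeasurableSet.of_discrete MeasurableSet.of_discrete,
    prodBernoulli_real_subset u F, glueSet_pushforward u w' (↑F) (fun e he => h1 e (Finset.mem_coe.1 he))
      (fun e he => h2 e (fun h => he (Finset.mem_coe.2 h))) Y]

/-- **Up-set exchange** (Kozma–Nitzan's Lemma 5 with the relay ranked in the unglued graph).  Let `w` have no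
positive non-loop pair inside `S`, let `v ∉ S`, and suppose `μ_w(a ↔ b) ≤ μ_w(v ↔ b)`.  Then for every finite
set `C` of non-loop pairs meeting `S` with `s(s₀, v) ∈ C` for some `s₀ ∈ S`:
`μ_{glue_S w}(a ↔ b, C open) ≤ μ_{glue_S w}(v ↔ b, C open)`.
[cite: KozmaNitzan2024, Lemma 5 and Lemma 3(i) (pp. 6, 13); VandenbergHaggstromKahn2005, Thm. 1.2] -/
theorem upsetExchange (w : Sym2 (Fin n) → unitInterval) (S : Finset (Fin n)) (a b v s₀ : Fin n)
    (hvS : v ∉ S) (hs₀ : s₀ ∈ S)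
    (hS0 : ∀ e : Sym2 (Fin n), (∀ x ∈ e, x ∈ S) → ¬ e.IsDiag → w e = 0)
    (C : Finset (Sym2 (Fin n))) (hC : ∀ e ∈ C, ¬ e.IsDiag ∧ ∃ x ∈ e, x ∈ S) (hsv : s(s₀, v) ∈ C)
    (hyp : (prodBernoulli w).real (openConn a b) ≤ (prodBernoulli w).real (openConn v b)) :
    (prodBernoulli (fun e : Sym2 (Fin n) => if (∀ x ∈ e, x ∈ S) ∧ ¬ e.IsDiag then 1 else w e)).real
        (openConn a b ∩ {ω | (↑C : Set (Sym2 (Fin n))) ⊆ ω}) ≤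
      (prodBernoulli (fun e : Sym2 (Fin n) => if (∀ x ∈ e, x ∈ S) ∧ ¬ e.IsDiag then 1 else w e)).real
        (openConn v b ∩ {ω | (↑C : Set (Sym2 (Fin n))) ⊆ ω}) := by
  classical
  set F : Finset (Sym2 (Fin n)) := Finset.univ.filter fun e => (∀ x ∈ e, x ∈ S) ∧ ¬ e.IsDiag with hF
  set wg : Sym2 (Fin n) → unitInterval := fun e => if (∀ x ∈ e, x ∈ S) ∧ ¬ e.IsDiag then 1 else w e
    with hwg
  have hmemF : ∀ e : Sym2 (Fin n), e ∈ F ↔ (∀ x ∈ e, x ∈ S) ∧ ¬ e.IsDiag := fun e => by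
    rw [hF, Finset.mem_filter]; exact ⟨fun h => h.2, fun h => ⟨Finset.mem_univ _, h⟩⟩
  have hvs₀ : v ≠ s₀ := fun h => hvS (h ▸ hs₀)
  refine le_of_forall_pos_le_add fun δ hδ => ?_
  -- an `ε ∈ (0, 1]` with `|F| ε ≤ δ`
  obtain ⟨ε, hε0, hε1, hεδ⟩ : ∃ ε : ℝ, 0 < ε ∧ ε ≤ 1 ∧ (F.card : ℝ) * ε ≤ δ := by
    refine ⟨min 1 (δ / (F.card + 1)), lt_min one_pos (div_pos hδ (by positivity)), min_le_left _ _, ?_⟩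
    calc (F.card : ℝ) * min 1 (δ / (F.card + 1)) ≤ (F.card + 1) * (δ / (F.card + 1)) :=
          mul_le_mul (by linarith) (min_le_right _ _) (le_min zero_le_one (div_nonneg hδ.le (by positivity)))
            (by positivity)
      _ = δ := by field_simp
  set εI : unitInterval := ⟨ε, hε0.le, hε1⟩ with hεI
  set wε : Sym2 (Fin n) → unitInterval := fun e => if e ∈ F then εI else w e with hwε
  have hwεF : ∀ e ∈ F, wε e = εI := fun e he => by simp only [hwε, if_pos he]
  have hwεF' : ∀ e ∉ F, wε e = w e := fun e he => by simp only [hwε, if_neg he]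
  have hwF0 : ∀ e ∈ F, w e = 0 := fun e he => hS0 e ((hmemF e).1 he).1 ((hmemF e).1 he).2
  have hwgF : ∀ e ∈ F, wg e = 1 := fun e he => by simp only [hwg, if_pos ((hmemF e).1 he)]
  have hwgF' : ∀ e ∉ F, wg e = wε e := fun e he => by
    rw [hwεF' e he]; simp only [hwg, if_neg (fun h => he ((hmemF e).2 h))]
  -- (1a) the weak side: `μ_{w_ε}(a ↔ b) ≤ μ_w(a ↔ b) + |F| ε`
  have h1a : (prodBernoulli wε).real (openConn a b) ≤ (prodBernoulli w).real (openConn a b) + F.card * ε := by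
    have hsub : (openConn a b : Set (BondConfig (Fin n))) ⊆
        {ω | ((ω \ ↑F : Set (Sym2 (Fin n))) : BondConfig (Fin n)) ∈ (openConn a b : Set (BondConfig (Fin n)))} ∪
          {ω | ∃ e ∈ F, e ∈ ω} := by
      intro ω hω
      by_cases hex : ∃ e ∈ F, e ∈ ω
      · exact Or.inr hex
      · left
        push Not at hex
        have hdiff : (ω \ ↑F : Set (Sym2 (Fin n))) = ω := by
          ext e
          simp only [Set.mem_sdiff, Finset.mem_coe, and_iff_left_iff_imp]
          exact fun he heF => hex e heF he
        show ((ω \ ↑F : Set (Sym2 (Fin n))) : BondConfig (Fin n)) ∈ (openConn a b : Set (BondConfig (Fin n)))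
        rw [hdiff]; exact hω
    have hkill := killSet_pushforward w wε (↑F) (fun e he => hwF0 e (Finset.mem_coe.1 he))
      (fun e he => hwεF' e (fun h => he (Finset.mem_coe.2 h))) (openConn a b)
    have hsum : (prodBernoulli wε).real {ω | ∃ e ∈ F, e ∈ ω} ≤ F.card * ε := by
      refine (prodBernoulli_real_exists_mem_le_sum wε F).trans (le_of_eq ?_)
      rw [Finset.sum_congr rfl (fun e he => by rw [hwεF e he]), Finset.sum_const, nsmul_eq_mul]
    calc (prodBernoulli wε).real (openConn a b)
        ≤ (prodBernoulli wε).real ({ω | ((ω \ ↑F : Set (Sym2 (Fin n))) : BondConfig (Fin n)) ∈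
              (openConn a b : Set (BondConfig (Fin n)))} ∪ {ω | ∃ e ∈ F, e ∈ ω}) :=
          measureReal_mono hsub
      _ ≤ (prodBernoulli wε).real {ω | ((ω \ ↑F : Set (Sym2 (Fin n))) : BondConfig (Fin n)) ∈
              (openConn a b : Set (BondConfig (Fin n)))} + (prodBernoulli wε).real {ω | ∃ e ∈ F, e ∈ ω} :=
          measureReal_union_le _ _
      _ ≤ (prodBernoulli w).real (openConn a b) + F.card * ε := by rw [← hkill]; linarith
  -- (1b) the strong side: `μ_w(v ↔ b) ≤ μ_{w_ε}(v ↔ b)`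
  have h1b : (prodBernoulli w).real (openConn v b) ≤ (prodBernoulli wε).real (openConn v b) := by
    refine prodBernoulli_real_mono_of_isUpperSet (fun e => ?_) (isUpperSet_openConn v b) MeasurableSet.of_discrete
    by_cases he : e ∈ F
    · rw [hwF0 e he, hwεF e he]; exact bot_le
    · rw [hwεF' e he]
  have h1 : (prodBernoulli wε).real (openConn a b) ≤ (prodBernoulli wε).real (openConn v b) + F.card * ε := by
    linarith
  -- (2) Lemma 3(i) with the up-set `{F ∪ C ⊆ C_v}`
  set 𝒬 : Set (Set (Sym2 (Fin n))) := {E | (↑F : Set (Sym2 (Fin n))) ⊆ E ∧ (↑C : Set (Sym2 (Fin n))) ⊆ E} with h𝒬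
  have h𝒬up : IsUpperSet 𝒬 := fun E E' hEE' hE => ⟨hE.1.trans hEE', hE.2.trans hEE'⟩
  have hQ : {ω : BondConfig (Fin n) | openEdgeCluster ω v ∈ 𝒬} =
      {ω | (↑F : Set (Sym2 (Fin n))) ⊆ ω} ∩ {ω | (↑C : Set (Sym2 (Fin n))) ⊆ ω} := by
    ext ω
    simp only [h𝒬, mem_setOf_eq, mem_inter_iff]
    constructor
    · rintro ⟨h1, h2⟩
      exact ⟨h1.trans (openEdgeCluster_subset ω v), h2.trans (openEdgeCluster_subset ω v)⟩
    · rintro ⟨h1, h2⟩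
      have key := subset_openEdgeCluster_of_open S C v s₀ hs₀ hsv hvs₀ hC ω
        (fun e heS hed => h1 (Finset.mem_coe.2 ((hmemF e).2 ⟨heS, hed⟩))) h2
      exact ⟨fun e he => key.1 e ((hmemF e).1 (Finset.mem_coe.1 he)).1 ((hmemF e).1 (Finset.mem_coe.1 he)).2, key.2⟩
  have L3 := KozmaNitzan2024_lemma3_i wε a v b (δ := F.card * ε) (by positivity) h1 h𝒬up
  rw [hQ] at L3
  -- (3) factor out the forced pairs of `F`
  have hfac : ∀ X : Set (BondConfig (Fin n)),
      (prodBernoulli wε).real (X ∩ ({ω | (↑F : Set (Sym2 (Fin n))) ⊆ ω} ∩ {ω | (↑C : Set (Sym2 (Fin n))) ⊆ ω})) =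
        ε ^ F.card * (prodBernoulli wg).real (X ∩ {ω | (↑C : Set (Sym2 (Fin n))) ⊆ ω}) := by
    intro X
    have hset : X ∩ ({ω | (↑F : Set (Sym2 (Fin n))) ⊆ ω} ∩ {ω | (↑C : Set (Sym2 (Fin n))) ⊆ ω}) =
        {ω | (↑F : Set (Sym2 (Fin n))) ⊆ ω} ∩
          {ω | ((ω ∪ ↑F : Set (Sym2 (Fin n))) : BondConfig (Fin n)) ∈ X ∩ {ω | (↑C : Set (Sym2 (Fin n))) ⊆ ω}} := by
      ext ω
      simp only [mem_inter_iff, mem_setOf_eq]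
      constructor
      · rintro ⟨hX, hFω, hCω⟩
        have hu : (ω ∪ ↑F : Set (Sym2 (Fin n))) = ω := Set.union_eq_self_of_subset_right hFω
        refine ⟨hFω, ?_, ?_⟩
        · show ((ω ∪ ↑F : Set (Sym2 (Fin n))) : BondConfig (Fin n)) ∈ X
          rw [hu]; exact hX
        · rw [hu]; exact hCω
      · rintro ⟨hFω, hX, hCω⟩
        have hu : (ω ∪ ↑F : Set (Sym2 (Fin n))) = ω := Set.union_eq_self_of_subset_right hFω
        rw [hu] at hX hCω
        exact ⟨hX, hFω, hCω⟩
    rw [hset, real_forceOpen_inter wε wg F hwgF hwgF', Finset.prod_congr rfl (fun e he => by rw [hwεF e he]),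
      Finset.prod_const]
  have hfacQ : (prodBernoulli wε).real ({ω | (↑F : Set (Sym2 (Fin n))) ⊆ ω} ∩ {ω | (↑C : Set (Sym2 (Fin n))) ⊆ ω}) =
      ε ^ F.card * (prodBernoulli wg).real {ω | (↑C : Set (Sym2 (Fin n))) ⊆ ω} := by
    have := hfac Set.univ
    rwa [Set.univ_inter, Set.univ_inter] at this
  rw [hfac, hfac, hfacQ] at L3
  -- (4) divide by `ε^{|F|}` and bound the error
  have hεpow : 0 < ε ^ F.card := pow_pos hε0 _
  have hPQ : (prodBernoulli wg).real {ω : BondConfig (Fin n) | (↑C : Set (Sym2 (Fin n))) ⊆ ω} ≤ 1 :=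
    measureReal_le_one
  have key : (prodBernoulli wg).real (openConn a b ∩ {ω | (↑C : Set (Sym2 (Fin n))) ⊆ ω}) ≤
      (prodBernoulli wg).real (openConn v b ∩ {ω | (↑C : Set (Sym2 (Fin n))) ⊆ ω}) +
        F.card * ε * (prodBernoulli wg).real {ω | (↑C : Set (Sym2 (Fin n))) ⊆ ω} := by
    have := L3
    have h' : ε ^ F.card * (prodBernoulli wg).real (openConn a b ∩ {ω | (↑C : Set (Sym2 (Fin n))) ⊆ ω}) ≤
        ε ^ F.card * ((prodBernoulli wg).real (openConn v b ∩ {ω | (↑C : Set (Sym2 (Fin n))) ⊆ ω}) +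
          F.card * ε * (prodBernoulli wg).real {ω | (↑C : Set (Sym2 (Fin n))) ⊆ ω}) := by
      nlinarith [this]
    exact le_of_mul_le_mul_left h' hεpow
  calc (prodBernoulli wg).real (openConn a b ∩ {ω | (↑C : Set (Sym2 (Fin n))) ⊆ ω})
      ≤ (prodBernoulli wg).real (openConn v b ∩ {ω | (↑C : Set (Sym2 (Fin n))) ⊆ ω}) +
          F.card * ε * (prodBernoulli wg).real {ω | (↑C : Set (Sym2 (Fin n))) ⊆ ω} := key
    _ ≤ (prodBernoulli wg).real (openConn v b ∩ {ω | (↑C : Set (Sym2 (Fin n))) ⊆ ω}) + δ := by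
          have : (F.card : ℝ) * ε * (prodBernoulli wg).real {ω : BondConfig (Fin n) | (↑C : Set (Sym2 (Fin n))) ⊆ ω}
              ≤ F.card * ε := by
            have h0 : (0 : ℝ) ≤ F.card * ε := by positivity
            nlinarith [measureReal_nonneg (μ := prodBernoulli wg) (s := {ω : BondConfig (Fin n) | (↑C : Set (Sym2 (Fin n))) ⊆ ω})]
          linarith

/-- **Block form**: under the hypotheses of `upsetExchange`, on `{C open}` the anchor `v` is glued to the block,
so `μ_{glue_S w}(a ↔ b, C open) ≤ μ_{glue_S w}(s₀ ↔ b, C open)` for the member `s₀ ∈ S`. [cite: KozmaNitzan2024, Lemma 5 (p. 13)] -/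
theorem upsetExchange_block (w : Sym2 (Fin n) → unitInterval) (S : Finset (Fin n)) (a b v s₀ : Fin n)
    (hvS : v ∉ S) (hs₀ : s₀ ∈ S)
    (hS0 : ∀ e : Sym2 (Fin n), (∀ x ∈ e, x ∈ S) → ¬ e.IsDiag → w e = 0)
    (C : Finset (Sym2 (Fin n))) (hC : ∀ e ∈ C, ¬ e.IsDiag ∧ ∃ x ∈ e, x ∈ S) (hsv : s(s₀, v) ∈ C)
    (hyp : (prodBernoulli w).real (openConn a b) ≤ (prodBernoulli w).real (openConn v b)) :
    (prodBernoulli (fun e : Sym2 (Fin n) => if (∀ x ∈ e, x ∈ S) ∧ ¬ e.IsDiag then 1 else w e)).real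
        (openConn a b ∩ {ω | (↑C : Set (Sym2 (Fin n))) ⊆ ω}) ≤
      (prodBernoulli (fun e : Sym2 (Fin n) => if (∀ x ∈ e, x ∈ S) ∧ ¬ e.IsDiag then 1 else w e)).real
        (openConn s₀ b ∩ {ω | (↑C : Set (Sym2 (Fin n))) ⊆ ω}) := by
  refine (upsetExchange w S a b v s₀ hvS hs₀ hS0 C hC hsv hyp).trans (measureReal_mono ?_)
  rintro ω ⟨hvb, hCω⟩
  refine ⟨?_, hCω⟩
  have he : s(s₀, v) ∈ ω := hCω (Finset.mem_coe.2 hsv)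
  have hadj : (openGraph ω).Adj s₀ v := (openGraph_adj ω s₀ v).2 ⟨he, fun h => hvS (h ▸ hs₀)⟩
  exact hadj.reachable.trans hvb

end UpsetExchange

end

end Summit.CriticalPhenomena.PercolationContinuityZ3.Theorems
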